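import Summits.ResolutionOfSingularities.ResolutionOfSingularities.Theorems.LossExitCone4
import HarnessLib

/-!
# LossExitCone5 — decomp-res node «LossExitCone» (lens-3 g27 «LossLayer» rev 3 addendum; critic row 220 + addendum;
LANDING ASK INBOX :1644), tree file 5/5 of the node

Content VERBATIM from the decomp-res lens-3 g27 «LossLayer» rev 3 addendum files
`HOME/decomp-res-lens-3/g27/land/LossExitCone{,2,3}.lean` (5d9cd97a / b64a38c9 / 60e238a8; RE-PIN STATUS 13:02:33Z;
critic row 220 + addendum); tree names LossExitCone/2 = lens (4), LossExitCone3 = lens (5), LossExitCone4/5 = lens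
(6) — provenance and the lens header in full in `LossExitCone`. `--kind proof --supports
stmt-ResolutionOfSingularities-27367`; no aside change, no item.

## This file

Continuation 2/2 of `LossExitCone4` (same namespace / sections of the node, cut at the tree's 400-line cap; section
variables / opens replayed): scopes `Switch` — carries `switch_succ_layer_kept`.

[WRITER NOTE (decomp-res writer g14): file split only (tree files ≤ 400 lines) — cut at the node's section
boundaries where possible (§1 | §2; §3–§3⁺ whole; §4 by the cap between two declarations with `section Switch` and
its `variable` line replayed); file-level `open` lines replayed in every part; every declaration, docstring and `/-!
## § -/` comment exactly as in the lens files.]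

(Sources: Hauser2010 §F; HauserPerlega2019 §2; CossartJannsenSaito2020 Ch. 8; Moh1987; Perlega2022.)
-/

open MvPolynomial Finset
open Literature.AlgebraicGeometry.Resolution
open Literature.AlgebraicGeometry.Resolution.Hauser2010
open Literature.AlgebraicGeometry.Resolution.PointBlowup
open Literature.AlgebraicGeometry.Resolution.WeightedBlowup
open Summit.ResolutionOfSingularities.ResolutionOfSingularities.Theorems.TightDefectClasses
open Summit.ResolutionOfSingularities.ResolutionOfSingularities.Theorems.TightDefectStrongWalks
open Summit.ResolutionOfSingularities.ResolutionOfSingularities.Theorems.ItineraryCutClasses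
open Summit.ResolutionOfSingularities.ResolutionOfSingularities.Theorems.BoundaryLedger
open Summit.ResolutionOfSingularities.ResolutionOfSingularities.Theorems.ProximityCut
open Summit.ResolutionOfSingularities.ResolutionOfSingularities.Theorems.ConeCut
open Summit.ResolutionOfSingularities.ResolutionOfSingularities.Theorems.WallCutRun

namespace Summit.ResolutionOfSingularities.ResolutionOfSingularities.Theorems.LossExitCone

section Switch

variable {K : Type} [Field K] [DecidableEq K] {q : ℕ} {s₀ : State (Fin 3) K}

/-- **THE EPISODE CONTINUES WITH THE ROLES OF `j` AND `l` EXCHANGED (PROVED):** after a switch that keeps the run wall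
(`W.b u i = 0`), the layer of `F_{u+1}` of `u_l`-degree exactly `m₁ = s+k+m−q` is `φ₀ · u_i^k u_l^{m₁} u_j^s · V₁` with
`V₁ = (u_j + β_j)^m`, `V₁(0) = β_j^m ≠ 0` — the run-stage shape `hlayer` again with `(j, l, m, V) ↦ (l, j, m₁, V₁)`: the new
«loss wall» is `E_l`, the new free letter is `j`; the run laws and this file's exit / switch laws apply to the next moves
verbatim. [new] [folklore] -/
theorem switch_succ_layer_kept (hroot : IsRoot q s₀) (W : ForcedWalk q s₀) (u : ℕ) {i j : Fin 3} {k m s : ℕ} {c : K}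
    {V : MvPolynomial (Fin 3) K} (hil : i ≠ W.j u) (hjl : j ≠ W.j u) (hij : i ≠ j)
    (hr : (W.st u).r = Finsupp.single i k + Finsupp.single j m)
    (hsh : (W.st u).shade = (s : ℕ∞)) (hplat : (W.st (u + 1)).shade = (W.st u).shade) (hq : q < s + k + m)
    (h1s : 1 ≤ s) (ha : c * coeff 0 V ≠ 0)
    (hlayer : ∀ D : Fin 3 →₀ ℕ, D j = m → coeff D (W.st u).F =
      coeff D (monomial (Finsupp.single i k + Finsupp.single j m + Finsupp.single (W.j u) s) c * V))
    (hβ : W.b u i = 0) (D : Fin 3 →₀ ℕ) (hD : D (W.j u) = s + k + m - q) :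
    coeff D (W.st (u + 1)).F = coeff D (monomial (Finsupp.single i k + Finsupp.single (W.j u) (s + k + m - q) +
      Finsupp.single j s) ((c * coeff 0 V) / (-W.b u j) ^ s) * (X j + C (W.b u j)) ^ m) := by
  classical
  have hsplit : D = Finsupp.erase (W.j u) D + Finsupp.single (W.j u) (s + k + m - q) := by
    rw [← hD, Finsupp.erase_add_single]
  have hEl : (Finsupp.erase (W.j u) D) (W.j u) = 0 := Finsupp.erase_same
  rw [hsplit, switch_succ_layer hroot W u hil hjl hij hr hsh hplat hq h1s ha hlayer _ hEl, hβ, C_0, add_zero, mul_right_comm,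
    X_pow_eq_monomial, X_pow_eq_monomial, monomial_mul, one_mul, coeff_monomial_mul', coeff_monomial_mul',
    add_right_comm (Finsupp.single i k) (Finsupp.single (W.j u) (s + k + m - q)) (Finsupp.single j s)]
  simp only [add_le_add_iff_right, add_tsub_add_eq_tsub_right]
  split_ifs <;> ring

end Switch

end Summit.ResolutionOfSingularities.ResolutionOfSingularities.Theorems.LossExitCone
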